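import Summits.QuantumFields.YangMills.Theorems.BalabanUVNodesN19TargetKeyedHomes
import Literature.MathematicalPhysics.QuantumFieldTheory.Balaban1983to89.Node00.Record13CoP
import Summits.QuantumFields.YangMills.Theorems.BalabanUVNodesN19SourceSplit

/-! v1.5 `CoP` EDITION (director-ym №160∕№162: FINDING №7, F7 adopted, HOLD-ALL, EDITION FREEZE; def-T FILE 23 `Node00/Record13CoP.lean` p520810 ✓, KEY-23) of my LANDED Co module
23ᶜᵒ (`…N19TargetAtRecord13Co`, p516083 ✓ — STANDS as a settled helper per №160 (5)): the SAME bytes under ONE more token rule (`₁₃Co ↦ ₁₃CoP` with `₁₃Core` protected, `13Co ↦ 13CoP`,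
`CCo ↦ CCoP`; KEY-23 governs); key `(h : θ.Provisos₁₃Core F N)` UNCHANGED (def-T Q1: token-identical).  Below: module 23ᶜᵒ's header under the map. -/

/-!
# BalabanUVNodes ∕ N19 (NE7 proper) — node U5's DECL TARGET AT NODE 00's STAGE-13 CORE(Co) RECORD `Node00.IsRecordOfRecord₁₃CCoP` (def-T FILE 21 `Node00/Record13CoP.lean`: RECORD 13 AT
# PRINT'S BACKGROUND `UbgOfRecord₁₃CoP`, the bg-free core tower ∕ datum `towerOfRecord₁₃CoP` ∕ `datumOfRecord₁₃CoP` keyed on the UNCHANGED `Stage13Params.Provisos₁₃Core`) — the CORE(Co)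
# EDITION of module 23 (`…N19TargetAtRecord13` p500640 (‴); `…N19TargetAtRecord13Sep` p505491 (⁗)) under def-T's KEY-RULE-21 (bus l.17980): key `Provisos₁₃Core` (R4) ·
# `datumOfRecord₁₃{·,Sep} ↦ datumOfRecord₁₃CoP` (R2∕R4) · `IsRecordOfRecord₁₃C{·,Sep} ↦ IsRecordOfRecord₁₃CCoP` (R1∕R4); proofs verbatim

Cell `pub-ymgap` (HUMAN RULING D-0062, Track A), R134 ACCELERATION seat `pub-ymgap-dag-n19-d` (strategy s2 «by-name knit at the record»), gen 8, module 23ᶜᵒ.  PROVENANCE: plan g67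
CORE-YES (bus l.17420: bg-BLIND consumer storeys — the spine ∕ rate homes and node U5's target modules — re-key ONCE to the bg-free core key and are then immune to every further
revision of the proviso rows) → director-ym №152 (bus l.17929, RULING (β): print's background is the minimiser over [6]'s class (6) = (1.7) ∧ (1.9), `UbgMSCoOfRecord` (def-R FILE 22
p512668); RECORD 13 is re-based ONCE at the Core root; the U_old-generated Core family `…₁₃Core` of v1.2 §9 is a pre-№152 sibling nobody keys on; consumers key ONCE on Core(Co)) →
def-T KEY-RULE-21 (bus l.17980, rules R1–R6: statement SHAPES preserved token for token, the only semantic change is `UbgOfRecord₁₃ ↦ UbgOfRecord₁₃CoP`).  Each item-keyed record class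
(v1.4 `IsRecordOfRecord₁₃CSepCoP`, def-T FILE 22T `Node00/Record13SepCoP.lean`) reaches the Core(Co) class along its one-way projection (`Provisos₁₃SepCoP.toCore`,
`datumOfRecord₁₃SepCoP := datumOfRecord₁₃CoP θ h.toCore` with `_eq_co : rfl`, `IsRecordOfRecord₁₃CSepCoP.toCo`), so THIS file's θ-keyed conclusions are the STRONGEST ones (most tuples)
and a thin item-keyed junction leaf reads them by one projection per binder.  Filed `--kind proof --supports stmt-QuantumFields-20292 --as helper` (K3⁗ `SpineGivenEndpointR13Sep`
until plan KEY-20 ∕ dag-lead WORDS-141 re-point the lane to K3⁵).  COUNT-NEUTRAL.  NO Theses import (restate-immune).  Modules 23 (‴) and 23⁗ (Sep) STAND unchanged; g7's prestaged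
U_old-Core image `…N19TargetAtRecord13Core` (INTENT-23ᶜ, bus l.17924) is NOT filed (dag-lead FOLD-152 (b)) — this file IS that image under `Core ↦ Co` in every non-key token.

WHAT IS INSTANTIATED.  Modules 6a∕6b (`…N19TargetKeyed(Homes)`, key-generic) at the Core(Co) key: `Θ F := Node00.Stage13Params F N`, `Hp θ := θ.Provisos₁₃Core F N`,
`Adm θ := θ.Admissible F N`, `datumOf θ h := Node00.datumOfRecord₁₃CoP F N θ h`, `Rec := Node00.IsRecordOfRecord₁₃CCoP F N`; (K1) = def-T `Node00.exists_provisos_of_isRecordOfRecord₁₃CCoP`;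
(K2) = def-T `Node00.exists_world_isRecordOfRecord₁₃CCoP` at the window `θ.γ` (inlined, three tokens; n27-c's corollaries `exists_world_of_keyed*` are the same step at the other keys)
— CITED; `hAvg` ∕ `hAvgD` = B1 (`Node00.isPrintedAveraged_of_isRecordOfRecord₁₃CCoP`, `Node00.isPrintedAveraged_datumOfRecord₁₃CoP`).  This file reads NO other Record-13 name: it is
DECOUPLED from node00-def-RR-2's key leaf and from dag-n27-c's ∕ dag-n22-e's Core(Co) carrier homes (those plug into §2's `hkeyS` ∕ `hkeyR` binders — module 23bᶜᵒ).
* §1 the Core(Co) record class: `AvgMeasurable`; B5 ⟺ `MatchingUnder D END` at every ₁₃CCoP record and at the θ-keyed datum; GUARDED variants (any guard `G θ`; the guard of record is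
  the θ-level `Node00.unityNondeg₁₃ N F θ := θ.ZtUnity F N ∧ θ.SlotsNondegenerate₁₃ F N`, key-independent, background-free); the literal :183 road, K4 consumed, the rate stubs
  with∕without U4′'s budget half, the budget road.
* §2 at Core(Co)-keyed CHARACTERISED carrier records (`hkeyS` ∕ `hkeyR`): `S_N19` under the pin = the keyed ∃δ-edge, the director's R134 row `HybridNE7` field by field under the pin
  (`summable := summable_deltaOfRecord` DISPLAYED content-free), node U5's target from the children's θ-indexed faces, from a divided pair of homes, the canonical-key road, and ★
  `coreEdge_keyed₁₃CoP_of_sourceSplitReading` — the K3 skeleton's `KeyedCoreEdge cr rr` shape at the Core(Co) key PRODUCED from dag-n19-e's (V)+(I) reading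
  (`N19SourceSplit.core_of_vacuum_of_insertion`).
* §3 world-free at the DATUM `Node00.datumOfRecord₁₃CoP F N θ h`: the :183 road from the ∃δ-edge and on the budget road.

HONEST FRAMING.  Re-keying bookkeeping: one-application instances; every stub, reading, characterisation, pin and edge is a HYPOTHESIS ∕ PARAMETER with no producer at the record today
(0∕1); nothing of Bałaban's is asserted or instantiated; NE7 ∕ NE7b ∕ NE7c NOT PRINTED for d = 4, NOT PROVED; NO node is discharged; K3⁗ NOT claimed; no record inhabitant claimed (K0⁗
`Record13SepInhabited` stmt-QuantumFields-20289 open; the Core(Co) class is WEAKER than every item class, so an inhabitant here would not be one there); counts UNMOVED (typed 28∕28 ·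
discharged 5∕27, A 5∕28); one finite four-torus programme at fixed `ε = L^{−K}` — NOT ℝ⁴, NOT infinite volume, NOT OS, NOT a mass gap, NOT Clay.  0 `def`, 0 `sorry`; no decl below
carries a cite tag (bookkeeping [folklore]).
-/

open Finset

namespace Summit.QuantumFields.YangMills.BalabanUVNodes.N19TargetAtRecord13CoP

open Literature.MathematicalPhysics.QuantumFieldTheory.Balaban1983to89
open Literature.MathematicalPhysics.QuantumFieldTheory.Balaban1983to89.T4Continuum
open T4WeightBudget (RelWeightBound)
open T4IndicatorShell (ShellWeightBound)
open T4GoodClassBudget (TermBudget)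
open T4MatchingAssembly (HybridNE7)
open T4CauchySum (MatchingModConstants)
open T4ContinuumYM4Torus (ForSmallCouplings)
open T4ApexVariance (MatchingUnder)
open Summit.QuantumFields.BalabanUV.T4Continuum.Spine
open Summit.QuantumFields.YangMills.BalabanUVNodes.N19AtSpineCarriers (deltaOfRecord summable_deltaOfRecord core_deltaOfRecord)
open Summit.QuantumFields.YangMills.BalabanUVNodes.N19TargetAtRecord11 (matching_scheme_of_coreEdge)
open Summit.QuantumFields.YangMills.BalabanUVNodes.N19BudgetRoadAtRecord11 (core_summable_of_termBudget_window)
open Summit.QuantumFields.YangMills.BalabanUVNodes.N19TargetKeyed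
open Summit.QuantumFields.YangMills.BalabanUVNodes.N19SourceSplit (core_of_vacuum_of_insertion)
open YMDAG.UVSplit
open Node00 (Stage13Params datumOfRecord₁₃CoP IsRecordOfRecord₁₃CCoP)

variable {N : ℕ} [NeZero N]

/-! ## §1 The Stage-13 (separated-range, rev 18) record class -/

section Record

variable (SRec : SpineRecordPred N) (RRec : RateRecordPred N) (Inputs : InputsPred N)

/-- **`AvgMeasurable` AT EVERY STAGE-13 DATUM OF RECORD** [bookkeeping]: B1 at the datum (def-T `Node00.isPrintedAveraged_datumOfRecord₁₃CoP`) — the averaging maps are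
the printed ones, measurable.  The `hAvgD` of module 6a at Stage 13. [folklore] -/
theorem avgMeasurable_datumOfRecord₁₃CoP {F : T4Family} (θ : Stage13Params F N) (h : θ.Provisos₁₃Core F N) : (datumOfRecord₁₃CoP F N θ h).AvgMeasurable :=
  (Node00.isPrintedAveraged_datumOfRecord₁₃CoP F N θ h).avgMeasurable

/-- **`AvgMeasurable` AT EVERY STAGE-13 CORE(Co) RECORD** [bookkeeping] (def-T `Node00.isPrintedAveraged_of_isRecordOfRecord₁₃CCoP`).  The `hAvg` of module 6a at Stage 13. [folklore] -/
theorem avgMeasurable_of_isRecordOfRecord₁₃CCoP {F : T4Family} {D : Datum F N} {w : DagBinding.WorldP} (hR : IsRecordOfRecord₁₃CCoP F N D w) : D.AvgMeasurable :=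
  (Node00.isPrintedAveraged_of_isRecordOfRecord₁₃CCoP hR).avgMeasurable

/-- **B5 ⇔ N19's TARGET AT ONE STAGE-13 CORE(Co) RECORD** [bookkeeping]: `HybridNE7Under D Hβ ↔ MatchingUnder D Hβ` at every ₁₃C record, every β-binder
(`T4MatchingDegenerate.hybridNE7Under_iff_matchingUnder`). [folklore] -/
theorem hybridNE7Under_iff_matchingUnder_of_isRecordOfRecord₁₃CCoP {F : T4Family} {D : Datum F N} {w : DagBinding.WorldP}
    (hR : IsRecordOfRecord₁₃CCoP F N D w) (Hβ : Prop) : T4ApexHybrid.HybridNE7Under D Hβ ↔ MatchingUnder D Hβ :=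
  T4MatchingDegenerate.hybridNE7Under_iff_matchingUnder D (avgMeasurable_of_isRecordOfRecord₁₃CCoP hR) Hβ

/-- **B5 AT THE STAGE-13 CORE(Co) RECORD CLASS ⟺ N19's DECL TARGET AT EVERY ₁₃C RECORD** [bookkeeping] (module 6a `spine_iff_matchingUnder`). [folklore] -/
theorem spine_rec13CCoP_iff_matchingUnder :
    Spine (N := N) (fun F D w => IsRecordOfRecord₁₃CCoP F N D w) ↔
      ∀ (F : T4Family) (D : Datum F N) (w : DagBinding.WorldP), IsRecordOfRecord₁₃CCoP F N D w → MatchingUnder D (DagBinding.EndpointExistence D.C.toB12) :=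
  spine_iff_matchingUnder _ fun _ _ _ hR => avgMeasurable_of_isRecordOfRecord₁₃CCoP hR

/-- **B5 AT ₁₃C GIVES N19's TARGET AT A ₁₃C RECORD** [bookkeeping]. [folklore] -/
theorem matchingUnder_of_spine_rec13CCoP (h : Spine (N := N) fun F D w => IsRecordOfRecord₁₃CCoP F N D w) {F : T4Family} {D : Datum F N}
    {w : DagBinding.WorldP} (hR : IsRecordOfRecord₁₃CCoP F N D w) : MatchingUnder D (DagBinding.EndpointExistence D.C.toB12) :=
  spine_rec13CCoP_iff_matchingUnder.mp h F D w hR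

/-- **… AND N19's TARGET AT EVERY ₁₃C RECORD GIVES B5 AT ₁₃C** [bookkeeping]. [folklore] -/
theorem spine_rec13CCoP_of_matchingUnder
    (h : ∀ (F : T4Family) (D : Datum F N) (w : DagBinding.WorldP), IsRecordOfRecord₁₃CCoP F N D w →
      MatchingUnder D (DagBinding.EndpointExistence D.C.toB12)) :
    Spine (N := N) fun F D w => IsRecordOfRecord₁₃CCoP F N D w :=
  spine_rec13CCoP_iff_matchingUnder.mpr h

/-- **N19's TARGET AT EVERY ₁₃C RECORD ⟺ AT EVERY ADMISSIBLE STAGE-13 DATUM OF RECORD** [bookkeeping] (worlds eliminated by (K1)(K2); module 6a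
`forall_matchingUnder_iff_forall_keyed`). [folklore] -/
theorem forall_record₁₃CoP_matchingUnder_iff_forall_datumOfRecord₁₃CoP :
    (∀ (F : T4Family) (D : Datum F N) (w : DagBinding.WorldP), IsRecordOfRecord₁₃CCoP F N D w → MatchingUnder D (DagBinding.EndpointExistence D.C.toB12)) ↔
      ∀ (F : T4Family) (θ : Stage13Params F N) (h : θ.Provisos₁₃Core F N), θ.Admissible F N →
        MatchingUnder (datumOfRecord₁₃CoP F N θ h) (DagBinding.EndpointExistence (datumOfRecord₁₃CoP F N θ h).C.toB12) :=
  forall_matchingUnder_iff_forall_keyed (Θ := fun F => Stage13Params F N) (fun θ => θ.Provisos₁₃Core _ N) (fun θ => θ.Admissible _ N)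
    (fun θ h => datumOfRecord₁₃CoP _ N θ h) (fun F D w => IsRecordOfRecord₁₃CCoP F N D w) (fun _ _ _ hR => Node00.exists_provisos_of_isRecordOfRecord₁₃CCoP hR)
    fun F θ hP hθ => (Node00.exists_world_isRecordOfRecord₁₃CCoP F N θ hP hθ (γw := θ.γ) ⟨hθ.toStage9.gamma_pos, le_rfl⟩).imp fun _ hw => hw.1

/-- **B5 AT ₁₃C ⟺ N19's TARGET AT EVERY ADMISSIBLE STAGE-13 DATUM** [bookkeeping] (module 6a `spine_iff_forall_keyed_matchingUnder`). [folklore] -/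
theorem spine_rec13CCoP_iff_forall_matchingUnder_datumOfRecord₁₃CoP :
    Spine (N := N) (fun F D w => IsRecordOfRecord₁₃CCoP F N D w) ↔
      ∀ (F : T4Family) (θ : Stage13Params F N) (h : θ.Provisos₁₃Core F N), θ.Admissible F N →
        MatchingUnder (datumOfRecord₁₃CoP F N θ h) (DagBinding.EndpointExistence (datumOfRecord₁₃CoP F N θ h).C.toB12) :=
  spine_rec13CCoP_iff_matchingUnder.trans forall_record₁₃CoP_matchingUnder_iff_forall_datumOfRecord₁₃CoP

/-- **B5 ⇔ N19's TARGET AT ONE STAGE-13 DATUM OF RECORD** [bookkeeping] (θ-keyed, world-free; every β-binder): B1 at the datum. [folklore] -/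
theorem hybridNE7Under_datumOfRecord₁₃CoP_iff_matchingUnder {F : T4Family} (θ : Stage13Params F N) (h : θ.Provisos₁₃Core F N) (Hβ : Prop) :
    T4ApexHybrid.HybridNE7Under (datumOfRecord₁₃CoP F N θ h) Hβ ↔ MatchingUnder (datumOfRecord₁₃CoP F N θ h) Hβ :=
  T4MatchingDegenerate.hybridNE7Under_iff_matchingUnder _ (avgMeasurable_datumOfRecord₁₃CoP θ h) Hβ

/-- **THE GUARDED θ-KEYED FORMS AGREE** [bookkeeping]: for ANY guard `G` on Stage-13 tuples (rev 16∕19's K3‴∕K3⁗ thread the GUARD OF RECORD `G θ := θ.ZtUnity F N ∧ θ.SlotsNondegenerate₁₃ F N` =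
RR-2's `Node00.unityNondeg₁₃ N`, print's partition of unity (3.16)–(3.20) and non-degenerate present slots), «`MatchingUnder (datumOfRecord₁₃CoP F N θ h) END` for every admissible θ with provisos and `G θ`» ⟺ the same with B5's
`HybridNE7Under` — N19's DECL target and binder B5 are one statement at the θ-keyed Stage-13 datum, guard or no guard. [folklore] -/
theorem forall_guarded_matchingUnder_datumOfRecord₁₃CoP_iff (G : ∀ {F : T4Family}, Stage13Params F N → Prop) :
    (∀ (F : T4Family) (θ : Stage13Params F N) (h : θ.Provisos₁₃Core F N), G θ → θ.Admissible F N →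
        MatchingUnder (datumOfRecord₁₃CoP F N θ h) (DagBinding.EndpointExistence (datumOfRecord₁₃CoP F N θ h).C.toB12)) ↔
      ∀ (F : T4Family) (θ : Stage13Params F N) (h : θ.Provisos₁₃Core F N), G θ → θ.Admissible F N →
        T4ApexHybrid.HybridNE7Under (datumOfRecord₁₃CoP F N θ h) (DagBinding.EndpointExistence (datumOfRecord₁₃CoP F N θ h).C.toB12) :=
  forall₃_congr fun _ θ h => forall₂_congr fun _ _ => (hybridNE7Under_datumOfRecord₁₃CoP_iff_matchingUnder θ h _).symm

/-- **A GUARD ONLY WEAKENS** [bookkeeping]: N19's target at every ₁₃C record gives the guarded θ-keyed form for every guard `G` ((K2) at Stage 13). [folklore] -/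
theorem forall_guarded_matchingUnder_datumOfRecord₁₃CoP_of_forall_record₁₃CoP (G : ∀ {F : T4Family}, Stage13Params F N → Prop)
    (h : ∀ (F : T4Family) (D : Datum F N) (w : DagBinding.WorldP), IsRecordOfRecord₁₃CCoP F N D w → MatchingUnder D (DagBinding.EndpointExistence D.C.toB12))
    (F : T4Family) (θ : Stage13Params F N) (hP : θ.Provisos₁₃Core F N) (_hG : G θ) (hθ : θ.Admissible F N) :
    MatchingUnder (datumOfRecord₁₃CoP F N θ hP) (DagBinding.EndpointExistence (datumOfRecord₁₃CoP F N θ hP).C.toB12) :=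
  forall_record₁₃CoP_matchingUnder_iff_forall_datumOfRecord₁₃CoP.mp h F θ hP hθ

/-- **THE LITERAL :183 ROAD AT EVERY STAGE-13 CORE(Co) RECORD, GUARDED BY K4's CONCLUSION** [bookkeeping] (module 6a `matching_at_rec_of_coreEdge` at ₁₃C): `S_N27x ₁₃C SRec` ·
`S_N20` · `S_N21` · U4′'s budget half · N19's ∃δ-edge ⇒ at every ₁₃C record with (B) and END, for all small-coupling tuned runs and every string carrying `Inputs`:
`∃ l₀ vol δ′, 0 < l₀ ∧ Summable δ′ ∧ MatchingModConstants vol l₀ δ′ (schemeZ (D.scheme g₀) os)`. [folklore] -/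
theorem matching_at_record₁₃CoP_of_coreEdge (hx : S_N27x (fun F D w => IsRecordOfRecord₁₃CCoP F N D w) SRec) (h20 : S_N20 SRec) (h21 : S_N21 SRec)
    (hlt : ∀ (F : T4Family) (D : Datum F N) (g₀ : ℕ → ℝ) (os : List (ULoop F)) (S : SpineCarriers), SRec F D g₀ os S → ∀ K, S.W K + S.Wsh K < 1)
    (hedge : ∀ (F : T4Family) (D : Datum F N) (g₀ : ℕ → ℝ) (os : List (ULoop F)) (S : SpineCarriers),
      SRec F D g₀ os S → Inputs F D g₀ os → letI := S.dec
      ∃ δ : ℕ → ℝ, NE7.Core S.l₀ S.vol S.T S.Bad (fun K t τ => S.A K t τ - S.shA K t τ) (fun K t τ => S.B K t τ - S.shB K t τ) δ ∧ Summable δ)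
    {F : T4Family} {D : Datum F N} {w : DagBinding.WorldP} (hR : IsRecordOfRecord₁₃CCoP F N D w)
    (hB : B16.EndStatementBPrinted D.C) (hE : DagBinding.EndpointExistence D.C.toB12) :
    ForSmallCouplings D fun g₀ => ∀ os : List (ULoop F), Inputs F D g₀ os →
      ∃ (l₀ vol : ℝ) (δ' : ℕ → ℝ), 0 < l₀ ∧ Summable δ' ∧ MatchingModConstants vol l₀ δ' (T4GenFunBounds.schemeZ (D.scheme g₀) os) :=
  matching_at_rec_of_coreEdge _ SRec Inputs (fun _ _ _ hR => avgMeasurable_of_isRecordOfRecord₁₃CCoP hR) hx h20 h21 hlt hedge hR hB hE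

/-- **… K4 CONSUMED: `MatchingUnder D END` AT EVERY STAGE-13 CORE(Co) RECORD** [bookkeeping] (module 6a `matchingUnder_at_rec_of_spineRates` at ₁₃C). [folklore] -/
theorem matchingUnder_at_record₁₃CoP_of_spineRates (hx : S_N27x (fun F D w => IsRecordOfRecord₁₃CCoP F N D w) SRec) (h20 : S_N20 SRec) (h21 : S_N21 SRec)
    (hlt : ∀ (F : T4Family) (D : Datum F N) (g₀ : ℕ → ℝ) (os : List (ULoop F)) (S : SpineCarriers), SRec F D g₀ os S → ∀ K, S.W K + S.Wsh K < 1)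
    (hedge : ∀ (F : T4Family) (D : Datum F N) (g₀ : ℕ → ℝ) (os : List (ULoop F)) (S : SpineCarriers),
      SRec F D g₀ os S → Inputs F D g₀ os → letI := S.dec
      ∃ δ : ℕ → ℝ, NE7.Core S.l₀ S.vol S.T S.Bad (fun K t τ => S.A K t τ - S.shA K t τ) (fun K t τ => S.B K t τ - S.shB K t τ) δ ∧ Summable δ)
    (h4 : SpineRates (fun F D w => IsRecordOfRecord₁₃CCoP F N D w) Inputs)
    {F : T4Family} {D : Datum F N} {w : DagBinding.WorldP} (hR : IsRecordOfRecord₁₃CCoP F N D w) :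
    MatchingUnder D (DagBinding.EndpointExistence D.C.toB12) :=
  matchingUnder_at_rec_of_spineRates _ SRec Inputs (fun _ _ _ hR => avgMeasurable_of_isRecordOfRecord₁₃CCoP hR) hx h20 h21 hlt hedge h4 hR

/-- **… BY NAME FROM THE RATE STUBS AND N19's RATE EDGE, THE LITERAL :183 ROAD** [bookkeeping] (module 6a `matchingUnder_at_rec_of_rateStubs` at ₁₃C): `S_R00x ₁₃C RRec` ·
`S_N14` … `S_N22` at `RRec` · `S_N27x ₁₃C SRec` · `S_N20` · `S_N21` · U4′'s budget half · «`SRec ∧ RRec ∧ RatesAt ⇒ ∃ δ, Core ∧ Summable δ`» ⇒ `MatchingUnder D END` at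
every ₁₃C record. [folklore] -/
theorem matchingUnder_at_record₁₃CoP_of_rateStubs (hxR : S_R00x (fun F D w => IsRecordOfRecord₁₃CCoP F N D w) RRec) (h14 : S_N14 RRec) (h15 : S_N15 RRec)
    (h16 : S_N16 RRec) (h17 : S_N17 RRec) (h18 : S_N18 RRec) (h22 : S_N22 RRec) (hx : S_N27x (fun F D w => IsRecordOfRecord₁₃CCoP F N D w) SRec)
    (h20 : S_N20 SRec) (h21 : S_N21 SRec)
    (hlt : ∀ (F : T4Family) (D : Datum F N) (g₀ : ℕ → ℝ) (os : List (ULoop F)) (S : SpineCarriers), SRec F D g₀ os S → ∀ K, S.W K + S.Wsh K < 1)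
    (hedgeR : ∀ (F : T4Family) (D : Datum F N) (g₀ : ℕ → ℝ) (os : List (ULoop F)) (S : SpineCarriers) (R : RateCarriers N),
      SRec F D g₀ os S → RRec F D g₀ os R → RatesAt D R → letI := S.dec
      ∃ δ : ℕ → ℝ, NE7.Core S.l₀ S.vol S.T S.Bad (fun K t τ => S.A K t τ - S.shA K t τ) (fun K t τ => S.B K t τ - S.shB K t τ) δ ∧ Summable δ)
    {F : T4Family} {D : Datum F N} {w : DagBinding.WorldP} (hR : IsRecordOfRecord₁₃CCoP F N D w) :
    MatchingUnder D (DagBinding.EndpointExistence D.C.toB12) :=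
  matchingUnder_at_rec_of_rateStubs _ SRec RRec (fun _ _ _ hR => avgMeasurable_of_isRecordOfRecord₁₃CCoP hR) hxR h14 h15 h16 h17 h18 h22 hx h20 h21 hlt
    hedgeR hR

/-- **… WITHOUT U4′'s BUDGET HALF (a tail property)** [bookkeeping] (module 6a `matchingUnder_at_rec_of_rateStubs_tail` at ₁₃C: n27-a XIV then the degenerate
expansion). [folklore] -/
theorem matchingUnder_at_record₁₃CoP_of_rateStubs_tail (hxR : S_R00x (fun F D w => IsRecordOfRecord₁₃CCoP F N D w) RRec) (h14 : S_N14 RRec) (h15 : S_N15 RRec)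
    (h16 : S_N16 RRec) (h17 : S_N17 RRec) (h18 : S_N18 RRec) (h22 : S_N22 RRec) (hx : S_N27x (fun F D w => IsRecordOfRecord₁₃CCoP F N D w) SRec)
    (h20 : S_N20 SRec) (h21 : S_N21 SRec)
    (hedgeR : ∀ (F : T4Family) (D : Datum F N) (g₀ : ℕ → ℝ) (os : List (ULoop F)) (S : SpineCarriers) (R : RateCarriers N),
      SRec F D g₀ os S → RRec F D g₀ os R → RatesAt D R → letI := S.dec
      ∃ δ : ℕ → ℝ, NE7.Core S.l₀ S.vol S.T S.Bad (fun K t τ => S.A K t τ - S.shA K t τ) (fun K t τ => S.B K t τ - S.shB K t τ) δ ∧ Summable δ)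
    {F : T4Family} {D : Datum F N} {w : DagBinding.WorldP} (hR : IsRecordOfRecord₁₃CCoP F N D w) :
    MatchingUnder D (DagBinding.EndpointExistence D.C.toB12) :=
  matchingUnder_at_rec_of_rateStubs_tail _ SRec RRec (fun _ _ _ hR => avgMeasurable_of_isRecordOfRecord₁₃CCoP hR) hxR h14 h15 h16 h17 h18 h22 hx h20 h21
    hedgeR hR

/-- **THE BUDGET ROAD AT EVERY STAGE-13 CORE(Co) RECORD, K4 CONSUMED** [bookkeeping] (module 6a `matchingUnder_at_rec_of_termBudgetReading` at ₁₃C; RELATIVE closer: the term-budget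
reading is the hypothesis, `Σ δ_K < ∞` proved from the window numerics). [folklore] -/
theorem matchingUnder_at_record₁₃CoP_of_termBudgetReading (hx : S_N27x (fun F D w => IsRecordOfRecord₁₃CCoP F N D w) SRec) (h20 : S_N20 SRec) (h21 : S_N21 SRec)
    (hlt : ∀ (F : T4Family) (D : Datum F N) (g₀ : ℕ → ℝ) (os : List (ULoop F)) (S : SpineCarriers), SRec F D g₀ os S → ∀ K, S.W K + S.Wsh K < 1)
    (hbud : ∀ (F : T4Family) (D : Datum F N) (g₀ : ℕ → ℝ) (os : List (ULoop F)) (S : SpineCarriers),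
      SRec F D g₀ os S → Inputs F D g₀ os → letI := S.dec
      ∃ (Cc Rr : ℕ → ℝ → S.ι → ℝ) (c₀ rO s : ℕ → ℝ) (Cw E₀ Cr a θ' Λg : ℝ) (m : ℕ),
        TermBudget S.l₀ S.vol S.T (fun K t τ => S.A K t τ - S.shA K t τ) (fun K t τ => S.B K t τ - S.shB K t τ) S.Bad Cc Rr c₀
          (fun K : ℕ => max Cw 1 * ((E₀ * ((K : ℝ) + 1) ^ m + Cr) * ∑ x ∈ antidiagonal K, min (a ^ x.2) (θ' ^ x.1 * Λg ^ x.2)) + rO K) s ∧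
        0 ≤ E₀ ∧ 0 ≤ Cr ∧ 0 < a ∧ a < 1 ∧ 0 < θ' ∧ θ' < 1 ∧ θ' ≤ Λg ∧ Summable rO ∧ Summable s)
    (h4 : SpineRates (fun F D w => IsRecordOfRecord₁₃CCoP F N D w) Inputs)
    {F : T4Family} {D : Datum F N} {w : DagBinding.WorldP} (hR : IsRecordOfRecord₁₃CCoP F N D w) :
    MatchingUnder D (DagBinding.EndpointExistence D.C.toB12) :=
  matchingUnder_at_rec_of_termBudgetReading _ SRec Inputs (fun _ _ _ hR => avgMeasurable_of_isRecordOfRecord₁₃CCoP hR) hx h20 h21 hlt hbud h4 hR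

end Record

/-! ## §2 At Stage-13 carrier records CHARACTERISED by readings off `(θ : Stage13Params F N, h : θ.Provisos₁₃Core F N)` — the homes' shape (`hkeyS` ∕ `hkeyR` are (T-SPINE)₁₃'s `sRec₁₃CoP_iff` ∕ a tuple-keyed rate home's unfolding; module 23b instantiates) -/

section Homes

variable (SRec : SpineRecordPred N) (RRec : RateRecordPred N) (Inputs : InputsPred N)
  (cr : ∀ {F : T4Family} (θ : Stage13Params F N), θ.Provisos₁₃Core F N → (ℕ → ℝ) → List (ULoop F) → SpineCarriers)
  (rr : ∀ {F : T4Family} (θ : Stage13Params F N), θ.Provisos₁₃Core F N → (ℕ → ℝ) → List (ULoop F) → RateCarriers N)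
  (hkeyS : ∀ (F : T4Family) (D : Datum F N) (g₀ : ℕ → ℝ) (os : List (ULoop F)) (S : SpineCarriers), SRec F D g₀ os S ↔
    ∃ (θ : Stage13Params F N) (h : θ.Provisos₁₃Core F N), θ.Admissible F N ∧ D = datumOfRecord₁₃CoP F N θ h ∧ S = cr θ h g₀ os)
  (hkeyR : ∀ (F : T4Family) (D : Datum F N) (g₀ : ℕ → ℝ) (os : List (ULoop F)) (R : RateCarriers N), RRec F D g₀ os R ↔
    ∃ (θ : Stage13Params F N) (h : θ.Provisos₁₃Core F N), θ.Admissible F N ∧ D = datumOfRecord₁₃CoP F N θ h ∧ R = rr θ h g₀ os)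
  (hpin : ∀ (F : T4Family) (θ : Stage13Params F N) (hP : θ.Provisos₁₃Core F N), θ.Admissible F N → ∀ (g₀ : ℕ → ℝ) (os : List (ULoop F)),
    letI := (cr θ hP g₀ os).dec
    (cr θ hP g₀ os).δ = deltaOfRecord (cr θ hP g₀ os).l₀ (cr θ hP g₀ os).vol (cr θ hP g₀ os).T (cr θ hP g₀ os).Bad
      (fun K t τ => (cr θ hP g₀ os).A K t τ - (cr θ hP g₀ os).shA K t τ) (fun K t τ => (cr θ hP g₀ os).B K t τ - (cr θ hP g₀ os).shB K t τ))

include hkeyS hpin in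
/-- **THE K5 STUB `S_N19` AT A CHARACTERISED STAGE-13 SPINE HOME, UNDER THE PIN, IS THE KEYED ∃δ-EDGE** [bookkeeping] (module 6b `s_N19_keyed_iff_coreEdge_of_pin` at the
Stage-13 key): `S_N19 SRec Inputs` ⟺ «for every admissible Stage-13 θ with provisos, every `g₀`, `os`: `Inputs` at `datumOfRecord₁₃CoP F N θ h` gives SOME summable `δ` with
`Spine.NE7.Core` on the shell-free cores of `cr θ h g₀ os`».  THE WHOLE N19 CONTENT AT STAGE 13 IS THAT EDGE. [folklore] -/
theorem s_N19_keyed₁₃CoP_iff_coreEdge_of_pin :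
    S_N19 SRec Inputs ↔ ∀ (F : T4Family) (θ : Stage13Params F N) (hP : θ.Provisos₁₃Core F N), θ.Admissible F N → ∀ (g₀ : ℕ → ℝ) (os : List (ULoop F)),
      Inputs F (datumOfRecord₁₃CoP F N θ hP) g₀ os → letI := (cr θ hP g₀ os).dec
      ∃ δ : ℕ → ℝ, NE7.Core (cr θ hP g₀ os).l₀ (cr θ hP g₀ os).vol (cr θ hP g₀ os).T (cr θ hP g₀ os).Bad
        (fun K t τ => (cr θ hP g₀ os).A K t τ - (cr θ hP g₀ os).shA K t τ) (fun K t τ => (cr θ hP g₀ os).B K t τ - (cr θ hP g₀ os).shB K t τ) δ ∧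
        Summable δ :=
  s_N19_keyed_iff_coreEdge_of_pin (Θ := fun F => Stage13Params F N) (fun θ => θ.Provisos₁₃Core _ N) (fun θ => θ.Admissible _ N)
    (fun θ h => datumOfRecord₁₃CoP _ N θ h) SRec Inputs cr hkeyS hpin

/-- **`HybridNE7` FIELD BY FIELD AT A CHARACTERISED STAGE-13 SPINE HOME, UNDER THE PIN** [bookkeeping] — the director's R134 row at Stage 13 (module 6b
`hybridNE7_keyed_of_pin`): `weight := S_N20 SRec` · `shell := S_N21 SRec` · `lt_one :=` the keyed budget half · `summable := summable_deltaOfRecord` (CONTENT-FREE, DISPLAYED)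
· `core := S_N19 SRec Inputs`, at every bundle `SRec` pins carrying `Inputs`.  (The characterisation `hkeyS` and the pin `hpin` are spelled out as binders here: this row's other
letters do not name the datum, and the v1.5 datum `datumOfRecord₁₃CoP` is what distinguishes it from module 23ᶜᵒ's Co row.) [folklore] -/
theorem hybridNE7_at_keyed₁₃CoP_of_pin
    (hkeyS : ∀ (F : T4Family) (D : Datum F N) (g₀ : ℕ → ℝ) (os : List (ULoop F)) (S : SpineCarriers), SRec F D g₀ os S ↔
      ∃ (θ : Stage13Params F N) (h : θ.Provisos₁₃Core F N), θ.Admissible F N ∧ D = datumOfRecord₁₃CoP F N θ h ∧ S = cr θ h g₀ os)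
    (hpin : ∀ (F : T4Family) (θ : Stage13Params F N) (hP : θ.Provisos₁₃Core F N), θ.Admissible F N → ∀ (g₀ : ℕ → ℝ) (os : List (ULoop F)),
      letI := (cr θ hP g₀ os).dec
      (cr θ hP g₀ os).δ = deltaOfRecord (cr θ hP g₀ os).l₀ (cr θ hP g₀ os).vol (cr θ hP g₀ os).T (cr θ hP g₀ os).Bad
        (fun K t τ => (cr θ hP g₀ os).A K t τ - (cr θ hP g₀ os).shA K t τ) (fun K t τ => (cr θ hP g₀ os).B K t τ - (cr θ hP g₀ os).shB K t τ))
    (h20 : S_N20 SRec) (h21 : S_N21 SRec)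
    (hlt : ∀ (F : T4Family) (θ : Stage13Params F N) (hP : θ.Provisos₁₃Core F N), θ.Admissible F N → ∀ (g₀ : ℕ → ℝ) (os : List (ULoop F)) (K : ℕ),
      (cr θ hP g₀ os).W K + (cr θ hP g₀ os).Wsh K < 1)
    (h19 : S_N19 SRec Inputs) {F : T4Family} {D : Datum F N} {g₀ : ℕ → ℝ} {os : List (ULoop F)} {S : SpineCarriers} (hS : SRec F D g₀ os S)
    (hI : Inputs F D g₀ os) : letI := S.dec
    HybridNE7 S.l₀ S.vol S.T S.A S.B S.Bad S.W S.shA S.shB S.Wsh S.δ :=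
  hybridNE7_keyed_of_pin (Θ := fun F => Stage13Params F N) (fun θ => θ.Provisos₁₃Core _ N) (fun θ => θ.Admissible _ N) (fun θ h => datumOfRecord₁₃CoP _ N θ h)
    SRec Inputs cr hkeyS hpin h20 h21 hlt h19 hS hI

/-- **N19's DECL TARGET AT EVERY STAGE-13 CORE(Co) RECORD FROM THE CHILDREN'S θ-INDEXED ESTIMATES ON THE SAME TUPLE** [bookkeeping] (module 6b `matchingUnder_keyed_of_keyedFaces` at the
Stage-13 key; readings `cr` ∕ `rr` PARAMETERS): N20 · N21 at `cr θ h g₀ os`, K4's six rates jointly at `rr θ h g₀ os` on `datumOfRecord₁₃CoP F N θ h`, the SAME-TUPLE N19′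
edge, the keyed extraction clause ⇒ `MatchingUnder D END` at every ₁₃C record. [folklore] -/
theorem matchingUnder_at_record₁₃CoP_of_keyedFaces
    (h20 : ∀ (F : T4Family) (θ : Stage13Params F N) (hP : θ.Provisos₁₃Core F N), θ.Admissible F N → ∀ (g₀ : ℕ → ℝ) (os : List (ULoop F)),
      RelWeightBound (cr θ hP g₀ os).l₀ (cr θ hP g₀ os).T (cr θ hP g₀ os).A (cr θ hP g₀ os).B (cr θ hP g₀ os).Bad (cr θ hP g₀ os).W)
    (h21 : ∀ (F : T4Family) (θ : Stage13Params F N) (hP : θ.Provisos₁₃Core F N), θ.Admissible F N → ∀ (g₀ : ℕ → ℝ) (os : List (ULoop F)),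
      ShellWeightBound (cr θ hP g₀ os).l₀ (cr θ hP g₀ os).T (cr θ hP g₀ os).A (cr θ hP g₀ os).B (cr θ hP g₀ os).shA (cr θ hP g₀ os).shB (cr θ hP g₀ os).Wsh)
    (hrates : ∀ (F : T4Family) (θ : Stage13Params F N) (hP : θ.Provisos₁₃Core F N), θ.Admissible F N → ∀ (g₀ : ℕ → ℝ) (os : List (ULoop F)),
      RatesAt (datumOfRecord₁₃CoP F N θ hP) (rr θ hP g₀ os))
    (h19 : ∀ (F : T4Family) (θ : Stage13Params F N) (hP : θ.Provisos₁₃Core F N), θ.Admissible F N → ∀ (g₀ : ℕ → ℝ) (os : List (ULoop F)),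
      RatesAt (datumOfRecord₁₃CoP F N θ hP) (rr θ hP g₀ os) → letI := (cr θ hP g₀ os).dec
        ∃ δ : ℕ → ℝ, NE7.Core (cr θ hP g₀ os).l₀ (cr θ hP g₀ os).vol (cr θ hP g₀ os).T (cr θ hP g₀ os).Bad
          (fun K t τ => (cr θ hP g₀ os).A K t τ - (cr θ hP g₀ os).shA K t τ) (fun K t τ => (cr θ hP g₀ os).B K t τ - (cr θ hP g₀ os).shB K t τ) δ ∧ Summable δ)
    (hx : ∀ (F : T4Family) (θ : Stage13Params F N) (hP : θ.Provisos₁₃Core F N), θ.Admissible F N →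
      B16.EndStatementBPrinted (datumOfRecord₁₃CoP F N θ hP).C → DagBinding.EndpointExistence (datumOfRecord₁₃CoP F N θ hP).C.toB12 →
        ForSmallCouplings (datumOfRecord₁₃CoP F N θ hP) fun g₀ => ∀ os : List (ULoop F),
          0 < (cr θ hP g₀ os).l₀ ∧ 0 < (cr θ hP g₀ os).vol ∧
          (∀ (K : ℕ) (t : ℝ), |t| ≤ (cr θ hP g₀ os).l₀ →
            T4GenFunBounds.schemeZ ((datumOfRecord₁₃CoP F N θ hP).scheme g₀) os ((cr θ hP g₀ os).K₀ + K) t = ∑ τ ∈ (cr θ hP g₀ os).T K, (cr θ hP g₀ os).A K t τ) ∧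
          (∀ (K : ℕ) (t : ℝ), |t| ≤ (cr θ hP g₀ os).l₀ →
            T4GenFunBounds.schemeZ ((datumOfRecord₁₃CoP F N θ hP).scheme g₀) os ((cr θ hP g₀ os).K₀ + K + 1) t =
              ∑ τ ∈ (cr θ hP g₀ os).T K, (cr θ hP g₀ os).B K t τ))
    {F : T4Family} {D : Datum F N} {w : DagBinding.WorldP} (hR : IsRecordOfRecord₁₃CCoP F N D w) :
    MatchingUnder D (DagBinding.EndpointExistence D.C.toB12) :=
  matchingUnder_keyed_of_keyedFaces (Θ := fun F => Stage13Params F N) (fun θ => θ.Provisos₁₃Core _ N) (fun θ => θ.Admissible _ N)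
    (fun θ h => datumOfRecord₁₃CoP _ N θ h) (fun F D w => IsRecordOfRecord₁₃CCoP F N D w) cr rr (fun _ _ _ hR => Node00.exists_provisos_of_isRecordOfRecord₁₃CCoP hR)
    (fun _ θ hP _ => avgMeasurable_datumOfRecord₁₃CoP θ hP) h20 h21 hrates h19 hx hR

include hkeyS hkeyR in
/-- **N19's DECL TARGET AT EVERY STAGE-13 CORE(Co) RECORD FROM THE STUB INSTANCES OF A DIVIDED PAIR OF STAGE-13 HOMES AND THE PAIR-FORM N19′ EDGE** [bookkeeping] (module 6b
`matchingUnder_keyed_of_rateStubs_twoKeys` at the Stage-13 key). [folklore] -/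
theorem matchingUnder_at_record₁₃CoP_of_rateStubs_twoKeys
    (hxR : S_R00x (fun F D w => IsRecordOfRecord₁₃CCoP F N D w) RRec) (h14 : S_N14 RRec) (h15 : S_N15 RRec) (h16 : S_N16 RRec) (h17 : S_N17 RRec)
    (h18 : S_N18 RRec) (h22 : S_N22 RRec) (hx : S_N27x (fun F D w => IsRecordOfRecord₁₃CCoP F N D w) SRec) (h20 : S_N20 SRec) (h21 : S_N21 SRec)
    (h19₂ : ∀ (F : T4Family) (θ : Stage13Params F N) (hP : θ.Provisos₁₃Core F N) (θ' : Stage13Params F N) (hP' : θ'.Provisos₁₃Core F N),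
      θ.Admissible F N → θ'.Admissible F N → datumOfRecord₁₃CoP F N θ' hP' = datumOfRecord₁₃CoP F N θ hP →
      ∀ (g₀ : ℕ → ℝ) (os : List (ULoop F)), RatesAt (datumOfRecord₁₃CoP F N θ hP) (rr θ' hP' g₀ os) → letI := (cr θ hP g₀ os).dec
        ∃ δ : ℕ → ℝ, NE7.Core (cr θ hP g₀ os).l₀ (cr θ hP g₀ os).vol (cr θ hP g₀ os).T (cr θ hP g₀ os).Bad
          (fun K t τ => (cr θ hP g₀ os).A K t τ - (cr θ hP g₀ os).shA K t τ) (fun K t τ => (cr θ hP g₀ os).B K t τ - (cr θ hP g₀ os).shB K t τ) δ ∧ Summable δ)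
    {F : T4Family} {D : Datum F N} {w : DagBinding.WorldP} (hR : IsRecordOfRecord₁₃CCoP F N D w) :
    MatchingUnder D (DagBinding.EndpointExistence D.C.toB12) :=
  matchingUnder_keyed_of_rateStubs_twoKeys (Θ := fun F => Stage13Params F N) (fun θ => θ.Provisos₁₃Core _ N) (fun θ => θ.Admissible _ N)
    (fun θ h => datumOfRecord₁₃CoP _ N θ h) (fun F D w => IsRecordOfRecord₁₃CCoP F N D w) SRec RRec cr rr hkeyS hkeyR
    (fun _ _ _ hR => Node00.exists_provisos_of_isRecordOfRecord₁₃CCoP hR) (fun _ θ hP _ => avgMeasurable_datumOfRecord₁₃CoP θ hP)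
    hxR h14 h15 h16 h17 h18 h22 hx h20 h21 h19₂ hR

include hkeyS hkeyR in
/-- **THE CANONICAL-KEY ROAD AT STAGE 13** [bookkeeping] (module 6b `matchingUnder_keyed_of_rateStubs_twoKeys_of_datumDetermined`): with a DATUM-DETERMINED Stage-13 rate reading
(the (T-RATE)₁₃ home's key: a datum-determination face of node00-def-RR-2's key leaf) the single-tuple N19′ edge `h19` suffices. [folklore] -/
theorem matchingUnder_at_record₁₃CoP_of_rateStubs_twoKeys_of_datumDetermined
    (hdetR : ∀ (F : T4Family) (θ : Stage13Params F N) (hP : θ.Provisos₁₃Core F N) (θ' : Stage13Params F N) (hP' : θ'.Provisos₁₃Core F N),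
      θ.Admissible F N → θ'.Admissible F N → datumOfRecord₁₃CoP F N θ' hP' = datumOfRecord₁₃CoP F N θ hP →
      ∀ (g₀ : ℕ → ℝ) (os : List (ULoop F)), rr θ' hP' g₀ os = rr θ hP g₀ os)
    (hxR : S_R00x (fun F D w => IsRecordOfRecord₁₃CCoP F N D w) RRec) (h14 : S_N14 RRec) (h15 : S_N15 RRec) (h16 : S_N16 RRec) (h17 : S_N17 RRec)
    (h18 : S_N18 RRec) (h22 : S_N22 RRec) (hx : S_N27x (fun F D w => IsRecordOfRecord₁₃CCoP F N D w) SRec) (h20 : S_N20 SRec) (h21 : S_N21 SRec)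
    (h19 : ∀ (F : T4Family) (θ : Stage13Params F N) (hP : θ.Provisos₁₃Core F N), θ.Admissible F N → ∀ (g₀ : ℕ → ℝ) (os : List (ULoop F)),
      RatesAt (datumOfRecord₁₃CoP F N θ hP) (rr θ hP g₀ os) → letI := (cr θ hP g₀ os).dec
        ∃ δ : ℕ → ℝ, NE7.Core (cr θ hP g₀ os).l₀ (cr θ hP g₀ os).vol (cr θ hP g₀ os).T (cr θ hP g₀ os).Bad
          (fun K t τ => (cr θ hP g₀ os).A K t τ - (cr θ hP g₀ os).shA K t τ) (fun K t τ => (cr θ hP g₀ os).B K t τ - (cr θ hP g₀ os).shB K t τ) δ ∧ Summable δ)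
    {F : T4Family} {D : Datum F N} {w : DagBinding.WorldP} (hR : IsRecordOfRecord₁₃CCoP F N D w) :
    MatchingUnder D (DagBinding.EndpointExistence D.C.toB12) :=
  matchingUnder_keyed_of_rateStubs_twoKeys_of_datumDetermined (Θ := fun F => Stage13Params F N) (fun θ => θ.Provisos₁₃Core _ N) (fun θ => θ.Admissible _ N)
    (fun θ h => datumOfRecord₁₃CoP _ N θ h) (fun F D w => IsRecordOfRecord₁₃CCoP F N D w) SRec RRec cr rr hkeyS hkeyR
    (fun _ _ _ hR => Node00.exists_provisos_of_isRecordOfRecord₁₃CCoP hR) (fun _ θ hP _ => avgMeasurable_datumOfRecord₁₃CoP θ hP)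
    hdetR hxR h14 h15 h16 h17 h18 h22 hx h20 h21 h19 hR

/-- **THE SAME-TUPLE SINGLE-BUNDLE ∃δ-EDGE — plan g66∕g67's registered K3 skeleton predicate `KeyedCoreEdge cr rr` (`D66-REV16/K3Skeleton13.lean` §1 under KEY-RULE-21's Core(Co) tokens), binder for binder — PRODUCED BY A
SOURCE-SPLIT READING** [bookkeeping] (n19-e `N19SourceSplit.core_of_vacuum_of_insertion` BY NAME at every tuple): if at every admissible Stage-13 θ with provisos, every `g₀`, `os`,
GIVEN the six rates `RatesAt (datumOfRecord₁₃CoP F N θ hP) (rr θ hP g₀ os)`, the reading `S := cr θ hP g₀ os` has POSITIVE shell-free cores on its good classes and carries (V) a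
class-uniform VACUUM matching and (I) a per-class SOURCE-RESPONSE matching of `log (B − shB) − log (A − shA)` with SUMMABLE remainders `δ⁰`, `δ¹`, then the edge holds with
`δ := δ⁰ + δ¹`.  (V) and (I) are dag-n19-e's located FIRST MISSING ESTIMATE of N19 (two-run statements, NOT PRINTED for d = 4); nothing is produced here — this is the `h19` of
`matchingUnder_at_record₁₃CoP_of_keyedFaces` (and of n27-c XXXVI∕XXXVI⁗ `spine_rec13C[Sep]_of_keyedFaces` ∕ the skeleton's `stub_expansion13` conjunct) in the source-split currency. [folklore] -/
theorem coreEdge_keyed₁₃CoP_of_sourceSplitReading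
    (hread : ∀ (F : T4Family) (θ : Stage13Params F N) (hP : θ.Provisos₁₃Core F N), θ.Admissible F N → ∀ (g₀ : ℕ → ℝ) (os : List (ULoop F)),
      RatesAt (datumOfRecord₁₃CoP F N θ hP) (rr θ hP g₀ os) → letI := (cr θ hP g₀ os).dec
      (∀ K t, |t| ≤ (cr θ hP g₀ os).l₀ → ∀ τ ∈ (cr θ hP g₀ os).T K \ (cr θ hP g₀ os).Bad K t,
        0 < (cr θ hP g₀ os).A K t τ - (cr θ hP g₀ os).shA K t τ ∧ 0 < (cr θ hP g₀ os).B K t τ - (cr θ hP g₀ os).shB K t τ) ∧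
      ∃ δ₀ δ₁ : ℕ → ℝ, Summable δ₀ ∧ Summable δ₁ ∧
        (∀ K, ∃ c : ℝ, ∀ t : ℝ, |t| ≤ (cr θ hP g₀ os).l₀ → ∀ τ ∈ (cr θ hP g₀ os).T K \ (cr θ hP g₀ os).Bad K t,
          |Real.log ((cr θ hP g₀ os).B K 0 τ - (cr θ hP g₀ os).shB K 0 τ) - Real.log ((cr θ hP g₀ os).A K 0 τ - (cr θ hP g₀ os).shA K 0 τ) - c| ≤
            (cr θ hP g₀ os).vol * δ₀ K) ∧
        (∀ K (t : ℝ), |t| ≤ (cr θ hP g₀ os).l₀ → ∀ τ ∈ (cr θ hP g₀ os).T K \ (cr θ hP g₀ os).Bad K t,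
          |(Real.log ((cr θ hP g₀ os).B K t τ - (cr θ hP g₀ os).shB K t τ) - Real.log ((cr θ hP g₀ os).A K t τ - (cr θ hP g₀ os).shA K t τ)) -
              (Real.log ((cr θ hP g₀ os).B K 0 τ - (cr θ hP g₀ os).shB K 0 τ) - Real.log ((cr θ hP g₀ os).A K 0 τ - (cr θ hP g₀ os).shA K 0 τ))| ≤
            (cr θ hP g₀ os).vol * δ₁ K))
    (F : T4Family) (θ : Stage13Params F N) (hP : θ.Provisos₁₃Core F N) (hθ : θ.Admissible F N) (g₀ : ℕ → ℝ) (os : List (ULoop F))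
    (hr : RatesAt (datumOfRecord₁₃CoP F N θ hP) (rr θ hP g₀ os)) : letI := (cr θ hP g₀ os).dec
    ∃ δ : ℕ → ℝ, NE7.Core (cr θ hP g₀ os).l₀ (cr θ hP g₀ os).vol (cr θ hP g₀ os).T (cr θ hP g₀ os).Bad
      (fun K t τ => (cr θ hP g₀ os).A K t τ - (cr θ hP g₀ os).shA K t τ) (fun K t τ => (cr θ hP g₀ os).B K t τ - (cr θ hP g₀ os).shB K t τ) δ ∧ Summable δ := by
  letI := (cr θ hP g₀ os).dec
  obtain ⟨hpos, δ₀, δ₁, h0, h1, hV, hI⟩ := hread F θ hP hθ g₀ os hr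
  exact ⟨fun K => δ₀ K + δ₁ K,
    core_of_vacuum_of_insertion (fun K t ht τ hτ => (hpos K t ht τ hτ).1) (fun K t ht τ hτ => (hpos K t ht τ hτ).2) hV hI, h0.add h1⟩

end Homes

/-! ## §3 World-free at the Stage-13 DATUM `Node00.datumOfRecord₁₃CoP F N θ h` (θ-keyed — the sentence a `cr`-keyed home instantiates) -/

section Datum

variable {F : T4Family}
variable {ι : Type} [DecidableEq ι] {l₀ vol : ℝ} {T : ℕ → Finset ι} {A B shA shB : ℕ → ℝ → ι → ℝ} {Bad : ℕ → ℝ → Finset ι}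
  {W Wsh : ℕ → ℝ} {Cc Rr : ℕ → ℝ → ι → ℝ} {c₀ rO s : ℕ → ℝ} {Cw E₀ Cr a θ' Λg : ℝ} {m : ℕ}

/-- **N19's DECL TARGET AT A STAGE-13 DATUM OF RECORD, ∃δ-EDGE FORM, WORLD-FREE** [bookkeeping] (module 3 `matching_datumOfRecord₁₁_of_coreEdge` at Stage 13): for a Stage-13
tuple `θ` WITH ITS PROVISOS `h`, `g₀`, `os`, and carriers with `0 ≤ l₀`, `0 < vol`, N20 · N21 · U4′'s budget half · N19's ∃δ-edge · E1∕E2 against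
`schemeZ ((datumOfRecord₁₃CoP F N θ h).scheme g₀) os`: `∃ δ′, Summable δ′ ∧ MatchingModConstants vol l₀ δ′ (schemeZ …)` — module 1's `matching_scheme_of_coreEdge`, `AvgMeasurable`
from B1 at the datum. [folklore] -/
theorem matching_datumOfRecord₁₃CoP_of_coreEdge (θ : Stage13Params F N) (h : θ.Provisos₁₃Core F N) (g₀ : ℕ → ℝ) (os : List (ULoop F)) {K₀ : ℕ} (hl₀ : 0 ≤ l₀)
    (hvol : 0 < vol) (h20 : RelWeightBound l₀ T A B Bad W) (h21 : ShellWeightBound l₀ T A B shA shB Wsh) (hlt : ∀ K, W K + Wsh K < 1)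
    (hedge : ∃ δ : ℕ → ℝ, NE7.Core l₀ vol T Bad (fun K t τ => A K t τ - shA K t τ) (fun K t τ => B K t τ - shB K t τ) δ ∧ Summable δ)
    (hE1 : ∀ (K : ℕ) (t : ℝ), |t| ≤ l₀ → T4GenFunBounds.schemeZ ((datumOfRecord₁₃CoP F N θ h).scheme g₀) os (K₀ + K) t = ∑ τ ∈ T K, A K t τ)
    (hE2 : ∀ (K : ℕ) (t : ℝ), |t| ≤ l₀ → T4GenFunBounds.schemeZ ((datumOfRecord₁₃CoP F N θ h).scheme g₀) os (K₀ + K + 1) t = ∑ τ ∈ T K, B K t τ) :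
    ∃ δ' : ℕ → ℝ, Summable δ' ∧ MatchingModConstants vol l₀ δ' (T4GenFunBounds.schemeZ ((datumOfRecord₁₃CoP F N θ h).scheme g₀) os) :=
  matching_scheme_of_coreEdge (datumOfRecord₁₃CoP F N θ h) (avgMeasurable_datumOfRecord₁₃CoP θ h) g₀ os hl₀ hvol h20 h21 hlt hedge hE1 hE2

/-- **… AND ON THE BUDGET ROAD** [bookkeeping] (module 3 `matching_datumOfRecord₁₁_of_termBudget_window` at Stage 13): the ∃δ-edge replaced by the DISPLAYED per-term budget on the
margin window and its numerics. [folklore] -/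
theorem matching_datumOfRecord₁₃CoP_of_termBudget_window (θ : Stage13Params F N) (h : θ.Provisos₁₃Core F N) (g₀ : ℕ → ℝ) (os : List (ULoop F)) {K₀ : ℕ}
    (hl₀ : 0 ≤ l₀) (hvol : 0 < vol) (h20 : RelWeightBound l₀ T A B Bad W) (h21 : ShellWeightBound l₀ T A B shA shB Wsh) (hlt : ∀ K, W K + Wsh K < 1)
    (hT : TermBudget l₀ vol T (fun K t τ => A K t τ - shA K t τ) (fun K t τ => B K t τ - shB K t τ) Bad Cc Rr c₀
      (fun K : ℕ => max Cw 1 * ((E₀ * ((K : ℝ) + 1) ^ m + Cr) * ∑ x ∈ antidiagonal K, min (a ^ x.2) (θ' ^ x.1 * Λg ^ x.2)) + rO K) s)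
    (hE₀ : 0 ≤ E₀) (hCr : 0 ≤ Cr) (ha0 : 0 < a) (ha1 : a < 1) (hθ'0 : 0 < θ') (hθ'1 : θ' < 1) (hθ'Λ : θ' ≤ Λg) (hrO : Summable rO) (hs : Summable s)
    (hE1 : ∀ (K : ℕ) (t : ℝ), |t| ≤ l₀ → T4GenFunBounds.schemeZ ((datumOfRecord₁₃CoP F N θ h).scheme g₀) os (K₀ + K) t = ∑ τ ∈ T K, A K t τ)
    (hE2 : ∀ (K : ℕ) (t : ℝ), |t| ≤ l₀ → T4GenFunBounds.schemeZ ((datumOfRecord₁₃CoP F N θ h).scheme g₀) os (K₀ + K + 1) t = ∑ τ ∈ T K, B K t τ) :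
    ∃ δ' : ℕ → ℝ, Summable δ' ∧ MatchingModConstants vol l₀ δ' (T4GenFunBounds.schemeZ ((datumOfRecord₁₃CoP F N θ h).scheme g₀) os) :=
  matching_datumOfRecord₁₃CoP_of_coreEdge θ h g₀ os hl₀ hvol h20 h21 hlt ⟨_, core_summable_of_termBudget_window hT hE₀ hCr ha0 ha1 hθ'0 hθ'1 hθ'Λ hrO hs⟩ hE1 hE2

end Datum
end Summit.QuantumFields.YangMills.BalabanUVNodes.N19TargetAtRecord13CoP
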